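import Mathlib
import Summits.ResolutionOfSingularities.ResolutionOfSingularities.Theorems.RadicialJungCleanModelsLens5ArcAllDimCore
import HarnessLib

/-!
# THEOREM P in every dimension (lens 5, g20) — part 3/3: exit (1) ⇒ the conclusion in dimension `d`, THEOREM P_d, and `CleanLUArcAtDim p d` for every `p`, `d`

PORT (line lead `res-B-lead-1` g10, `--supports stmt-ResolutionOfSingularities-15917 --as helper`) of res-B-lens-5 g20's PORT-READY, sorry-free crux workfile
`Cruxes/DescentPerfectToAll/Lens5_ArcAllDim.lean` REV 2 (tree sha16 b1cb415ca1788138; crit TRIAGE-157/157b PASS; registrar BOOKED #12a), split into three modules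
under `Theorems/` with the declarations VERBATIM (namespace `…Theorems.RadicialJungCleanModels.Lens5ArcAllDim` instead of `…Cruxes.DescentPerfectToAll.Lens5ArcAllDim`)
and the three census `def`s (`CleanLUArcAtDim`, `RSOPCompletionAtDim`, `CleanLUArcAllDim`) replaced by DEF-FREE theorems whose statements are the def bodies
(kernel lane).  CONTENT (lens-5 g20): **THEOREM P in EVERY dimension** — clean local uniformization of the `K^p`-line of `g₀` at a ZERO-DIMENSIONAL DISCRETE
RANK-ONE valuation with NO best `p`-th-power approximation (class (A), «arcs»), at a regular finitely generated centre of ANY Krull dimension `d`, over EVERY ground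
field (LEMMA D-abs ✓ `Lens5.AbsDerivation.absDerivation_of_forall_pow_ne'` + the potential argument ✓ `Lens5.ArcPotentialProof` lineage with the dimension removed
+ the transport lemma `rsop_completion`).  For `d = 3` this is the landed ✓ `cleanLU3DefectArc_of_discrete`; for `d ≥ 4` it is the first kernel theorem of the
lineage in the regime of the PRICE `stub_cleanModelsDimGEFour` (class (A) only; strategically inert for rung B on its own, census-4 addenda B/C).
OURS · counted 0 · nothing here proves resolution in characteristic `p`; `CleanModels` and rung B are NOT proved.

This module: §Conclusion + §Main of the source (`concl_of_exit1_d`, `arcPotential_d` — THEOREM P_d with the derivation binder) and the def-free form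
`cleanLUArcAtDim p hp d` of the census statement `CleanLUArcAtDim p d` (res-B-lens-1 g3, body VERBATIM; `CleanLUArcAllDim p = ∀ d, CleanLUArcAtDim p d` is the
same theorem with `d` universally quantified), the derivation binder discharged by ✓ `Lens5.AbsDerivation.absDerivation_of_forall_pow_ne'`.
-/

noncomputable section

set_option linter.dupNamespace false -- mandated namespace of this single-conjunct summit

open IsLocalRing
open Literature.AlgebraicGeometry.Resolution
open Summit.ResolutionOfSingularities.ResolutionOfSingularities.Theorems.RadicialJung.CleanModels
open Summit.ResolutionOfSingularities.ResolutionOfSingularities.Theorems.RadicialJung.CleanModels.Lens5.ArcPotentialProof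

namespace Summit.ResolutionOfSingularities.ResolutionOfSingularities.Theorems.RadicialJungCleanModels.Lens5ArcAllDim

variable {K : Type} [Field K]

/-! ## Exit (1) ⇒ conclusion in dimension `d` -/

section Conclusion

variable {k : Type} [Field k] [Algebra k K]

/-- Exit (1) ⇒ conclusion, dimension `d`: the monomial `π^r F`, the independent pair `(π, F)` completed to a regular system of parameters
`t : Fin d → Rn` (`t 0 = π`, `t 1 = F`) by `rsop_completion`; `0 < r < p`. [folklore] -/
theorem concl_of_exit1_d {p : ℕ} [hp : Fact p.Prime] [CharP K p] {O : ValuationSubring K} {A A' : Subalgebra k K}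
    (hA'O : A'.toSubring ≤ O.toSubring) (hAA' : A ≤ A') (hA'fg : A'.FG)
    (Rn : Subring K) [IsLocalRing Rn] (hreg : IsRegularLocalRing Rn) (hRn : Rn = locAtCentre A'.toSubring O)
    {d : ℕ} (hdimRn : ringKrullDim Rn = (d : WithBot ℕ∞))
    (g₀ b c π : K) (hb : b ≠ 0) (hπ0 : π ≠ 0) (m' r : ℕ) (hr0 : 0 < r) (hrp : r < p)
    (hπn : π ∈ Rn) (F : Rn) (hπm : (⟨π, hπn⟩ : Rn) ∈ maximalIdeal Rn) (hπm2 : (⟨π, hπn⟩ : Rn) ∉ maximalIdeal Rn ^ 2)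
    (hFm : F ∈ maximalIdeal Rn) (hind : ∀ a' b' : Rn, a' * ⟨π, hπn⟩ + b' * F ∈ maximalIdeal Rn ^ 2 → b' ∈ maximalIdeal Rn)
    (heq : (b ^ p * g₀ - c ^ p) / π ^ (p * m') = π ^ r * (F : K)) :
    (∃ (A' : Subalgebra k K), A'.toSubring ≤ O.toSubring ∧ A ≤ A' ∧ A'.FG ∧
      ∃ (_ : IsRegularLocalRing (locAtCentre A'.toSubring O)) (c : Fin p → K), (∃ j : Fin p, (j : ℕ) ≠ 0 ∧ c j ≠ 0) ∧
      ((∃ (d m : ℕ) (hmd : m ≤ d) (t : Fin d → ↥(locAtCentre A'.toSubring O)) (a : Fin m → ℕ) (u : ↥(locAtCentre A'.toSubring O)), IsUnit u ∧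
      Ideal.span (Set.range t) = IsLocalRing.maximalIdeal ↥(locAtCentre A'.toSubring O) ∧
      ringKrullDim ↥(locAtCentre A'.toSubring O) = (d : WithBot ℕ∞) ∧ 0 < m ∧ (∀ i, ¬ p ∣ a i) ∧
      (∑ j : Fin p, c j ^ p * g₀ ^ (j : ℕ)) = (u : K) * ∏ i : Fin m, ((t (Fin.castLE hmd i) : ↥(locAtCentre A'.toSubring O)) : K) ^ (a i)) ∨
      (∃ u : ↥(locAtCentre A'.toSubring O), IsUnit u ∧ (∑ j : Fin p, c j ^ p * g₀ ^ (j : ℕ)) = (u : K) ∧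
      ∀ c' : ↥(locAtCentre A'.toSubring O), u - c' ^ p ∉ IsLocalRing.maximalIdeal ↥(locAtCentre A'.toSubring O)) ∨
      (∃ s c' : ↥(locAtCentre A'.toSubring O), (∑ j : Fin p, c j ^ p * g₀ ^ (j : ℕ)) = (s : K) ∧
      s - c' ^ p ∈ IsLocalRing.maximalIdeal ↥(locAtCentre A'.toSubring O) ∧
      s - c' ^ p ∉ IsLocalRing.maximalIdeal ↥(locAtCentre A'.toSubring O) ^ 2))) := by
  subst hRn
  haveI := hreg
  obtain ⟨h2, t, ht0, ht1, ht⟩ := rsop_completion hdimRn ⟨π, hπn⟩ F hπm hπm2 hFm hind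
  refine ⟨A', hA'O, hAA', hA'fg, hreg,
    fun j : Fin p => if (j : ℕ) = 0 then -c / π ^ m' else if (j : ℕ) = 1 then b / π ^ m' else 0, ?_, ?_⟩
  · refine ⟨⟨1, hp.out.one_lt⟩, one_ne_zero, ?_⟩
    simp only [one_ne_zero, if_false, if_true]
    exact div_ne_zero hb (pow_ne_zero _ hπ0)
  · refine Or.inl ⟨d, 2, h2, t, ![r, 1], 1, isUnit_one, ht, hdimRn, by norm_num, ?_, ?_⟩
    · intro i
      fin_cases i
      · exact Nat.not_dvd_of_pos_of_lt hr0 hrp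
      · exact hp.out.not_dvd_one
    · have e0 : t (Fin.castLE h2 0) = ⟨π, hπn⟩ := ht0 _ (by simp)
      have e1 : t (Fin.castLE h2 1) = F := ht1 _ (by simp)
      rw [sum_rep_eq, heq, Fin.prod_univ_two]
      simp only [e0, e1, Matrix.cons_val_zero, Matrix.cons_val_one, pow_one, Subring.coe_one, one_mul]


end Conclusion

/-! ## THEOREM P_d -/

section Main

variable {k : Type} [Field k] [Algebra k K]

/-- **THEOREM P_d** (THEOREM P of memo e709ae1b8c5f §2 in centre dimension `d`): class (A) — discrete rank-one `O`, `g₀` with no best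
`p`-th-power approximation, a derivation moving `g₀` with bounded denominators on `A` — has clean local uniformization in loose clean form,
for EVERY residue tower, EVERY ground field and EVERY dimension `d` (`d = 0` is contradictory, `d = 3` is ✓p691218; `_htd`, `_hdimA` unused). [folklore] -/
theorem arcPotential_d (p : ℕ) (hp : p.Prime) (d : ℕ) (k : Type) [Field k] [CharP k p] (K : Type) [Field K] [Algebra k K]
    (O : ValuationSubring K) (A : Subalgebra k K) (hAO : A.toSubring ≤ O.toSubring) (hAfg : A.FG)
    (hfrac : IsFractionRing A K) (_hdimA : ringKrullDim A ≤ (d : WithBot ℕ∞)) (hreg : IsRegularLocalRing (locAtCentre A.toSubring O))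
    (hdim : ringKrullDim (locAtCentre A.toSubring O) = (d : WithBot ℕ∞))
    (hzd : ∀ (T : Subring K) (hT : T ≤ O.toSubring), A.toSubring ≤ T → (subringCentre T O hT).IsMaximal)
    (g₀ : K) (hg₀ : ∀ c : K, c ^ p ≠ g₀)
    (hdefect : ∀ f₀ : K, ∃ f₁ : K, O.valuation (g₀ - f₁ ^ p) < O.valuation (g₀ - f₀ ^ p))
    (_htd : ∀ hk : ∀ c : k, algebraMap k K c ∈ O, transcendenceDefect k O hk ≠ 0)
    (hdisc : ∃ π : K, π ≠ 0 ∧ (∀ x : K, O.valuation x < 1 → O.valuation x ≤ O.valuation π) ∧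
      (∀ x : K, x ≠ 0 → ∃ n : ℕ, O.valuation π ^ n ≤ O.valuation x))
    (hDer : ∃ (D : Derivation ℤ K K) (s : K), s ≠ 0 ∧ (∀ y : K, y ∈ A → s * D y ∈ A) ∧ D g₀ ≠ 0) :
    (∃ (A' : Subalgebra k K), A'.toSubring ≤ O.toSubring ∧ A ≤ A' ∧ A'.FG ∧
      ∃ (_ : IsRegularLocalRing (locAtCentre A'.toSubring O)) (c : Fin p → K), (∃ j : Fin p, (j : ℕ) ≠ 0 ∧ c j ≠ 0) ∧
      ((∃ (d m : ℕ) (hmd : m ≤ d) (t : Fin d → ↥(locAtCentre A'.toSubring O)) (a : Fin m → ℕ) (u : ↥(locAtCentre A'.toSubring O)), IsUnit u ∧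
      Ideal.span (Set.range t) = IsLocalRing.maximalIdeal ↥(locAtCentre A'.toSubring O) ∧
      ringKrullDim ↥(locAtCentre A'.toSubring O) = (d : WithBot ℕ∞) ∧ 0 < m ∧ (∀ i, ¬ p ∣ a i) ∧
      (∑ j : Fin p, c j ^ p * g₀ ^ (j : ℕ)) = (u : K) * ∏ i : Fin m, ((t (Fin.castLE hmd i) : ↥(locAtCentre A'.toSubring O)) : K) ^ (a i)) ∨
      (∃ u : ↥(locAtCentre A'.toSubring O), IsUnit u ∧ (∑ j : Fin p, c j ^ p * g₀ ^ (j : ℕ)) = (u : K) ∧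
      ∀ c' : ↥(locAtCentre A'.toSubring O), u - c' ^ p ∉ IsLocalRing.maximalIdeal ↥(locAtCentre A'.toSubring O)) ∨
      (∃ s c' : ↥(locAtCentre A'.toSubring O), (∑ j : Fin p, c j ^ p * g₀ ^ (j : ℕ)) = (s : K) ∧
      s - c' ^ p ∈ IsLocalRing.maximalIdeal ↥(locAtCentre A'.toSubring O) ∧
      s - c' ^ p ∉ IsLocalRing.maximalIdeal ↥(locAtCentre A'.toSubring O) ^ 2))) := by
  obtain ⟨π, hπ0, hπ, harch⟩ := hdisc
  obtain ⟨D, s, hs0, hDA, hDg⟩ := hDer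
  classical
  haveI : Fact p.Prime := ⟨hp⟩
  haveI : CharP K p := charP_of_injective_algebraMap (algebraMap k K).injective p
  -- `v π < 1` WITHOUT the sequence: `g₀` has no best `p`-th-power approximation, so `O ≠ K` and `π` is a non-unit of `O`
  have hg0 : g₀ ≠ 0 := fun h0 => hg₀ 0 (by rw [h0, zero_pow hp.ne_zero])
  have hvπ : O.valuation π < 1 := by
    obtain ⟨f₁, hf₁⟩ := hdefect 0
    rw [zero_pow hp.ne_zero, sub_zero] at hf₁
    have hy0 : g₀ - f₁ ^ p ≠ 0 := sub_ne_zero.mpr (Ne.symm (hg₀ f₁))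
    have hvg : O.valuation g₀ ≠ 0 := (Valuation.ne_zero_iff _).mpr hg0
    have hz : O.valuation ((g₀ - f₁ ^ p) / g₀) < 1 := by
      rw [map_div₀, div_lt_one₀ (zero_lt_iff.mpr hvg)]; exact hf₁
    have hz0 : (g₀ - f₁ ^ p) / g₀ ≠ 0 := div_ne_zero hy0 hg0
    obtain ⟨n, hn⟩ := harch _ hz0
    by_contra hge
    push Not at hge
    have : (1 : O.ValueGroup) ≤ O.valuation π ^ n := one_le_pow₀ hge
    exact absurd (this.trans hn) (not_le.mpr hz)
  have hπO : π ∈ O := by rw [← O.valuation_le_one_iff]; exact hvπ.le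
  have hvπpos : 0 < O.valuation π := zero_lt_iff.mpr ((Valuation.ne_zero_iff _).mpr hπ0)
  -- `d ≠ 0`: a regular local ring of dimension `0` is a field, and then `v` would be trivial on `K = Frac A`
  have hd : ringKrullDim (locAtCentre A.toSubring O) ≠ 0 := by
    intro h0
    haveI := hreg
    have hsf : (maximalIdeal (locAtCentre A.toSubring O)).spanFinrank = 0 := by
      have e := IsRegularLocalRing.spanFinrank_maximalIdeal (R := locAtCentre A.toSubring O)
      rw [h0] at e; exact_mod_cast e
    obtain ⟨x, hx⟩ := exists_regularSystemOfParameters (R := locAtCentre A.toSubring O)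
    have hbot : maximalIdeal (locAtCentre A.toSubring O) = ⊥ := by
      rw [← hx, Ideal.span_eq_bot]
      rintro _ ⟨i, rfl⟩
      exact (Fin.cast hsf i).elim0
    have hLO : SubringDominates (locAtCentre A.toSubring O) O.toSubring := subringDominates_locAtCentre hAO
    have hmemL : ∀ a : locAtCentre A.toSubring O, a ∈ maximalIdeal _ ↔ O.valuation (a : K) < 1 :=
      fun a => (subringDominates_valuationSubring_iff hLO.1).mp hLO a
    have hv1 : ∀ a : K, a ∈ A → a ≠ 0 → O.valuation a = 1 := by
      intro a ha ha0
      have haL : a ∈ locAtCentre A.toSubring O := le_locAtCentre _ O ha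
      have hle : O.valuation a ≤ 1 := (O.valuation_le_one_iff _).mpr (hAO ha)
      refine le_antisymm hle (not_lt.mp fun hlt => ha0 ?_)
      have hm : (⟨a, haL⟩ : locAtCentre A.toSubring O) ∈ maximalIdeal _ := (hmemL ⟨a, haL⟩).mpr hlt
      rw [hbot, Ideal.mem_bot] at hm
      exact congrArg Subtype.val hm
    obtain ⟨a, b, hb, hab⟩ := IsFractionRing.div_surjective (A := A) π
    have hab' : (a : K) / (b : K) = π := hab
    have hb0 : (b : K) ≠ 0 := fun h => nonZeroDivisors.ne_zero hb (Subtype.ext h)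
    have ha0 : (a : K) ≠ 0 := by
      intro h; apply hπ0; rw [← hab', h, zero_div]
    have h1 : O.valuation π = 1 := by rw [← hab', map_div₀, hv1 _ a.2 ha0, hv1 _ b.2 hb0, div_one]
    exact absurd h1 hvπ.ne
  -- (0) the quadratic sequence package
  obtain ⟨R, hR0, hstep, hregR, hdimR, hmodel⟩ := exists_quadraticSeq_package A O hAO hAfg hreg hd hzd
  haveI hRloc : ∀ i, IsLocalRing (R i) := fun i => by haveI := hregR i; infer_instance
  have h0dom : SubringDominates (R 0) O.toSubring := by rw [hR0]; exact subringDominates_locAtCentre hAO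
  have hdom : ∀ i, SubringDominates (R i) O.toSubring := fun i => (sequence_dominates h0dom hstep i).1
  have hmono : ∀ {i j : ℕ}, i ≤ j → R i ≤ R j := fun hij => sequence_monotone hstep hij
  have hof : IsLocalRingOf (R 0) := by rw [hR0]; exact isLocalRingOf_locAtCentre A O hAO
  have hdimRd : ∀ i, ringKrullDim (R i) = (d : WithBot ℕ∞) := fun i => (hdimR i).trans hdim
  have hAR0 : A.toSubring ≤ R 0 := by rw [hR0]; exact le_locAtCentre _ O
  have hmemR : ∀ i (a : R i), a ∈ maximalIdeal (R i) ↔ O.valuation (a : K) < 1 := fun i =>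
    (subringDominates_valuationSubring_iff (hdom i).1).mp (hdom i)
  -- (1) `h = b^p g₀ ∈ A`
  obtain ⟨a, b, hb, hab⟩ := IsFractionRing.div_surjective (A := A) g₀
  have hab' : (a : K) / (b : K) = g₀ := hab
  have hb0 : (b : K) ≠ 0 := fun h => nonZeroDivisors.ne_zero hb (Subtype.ext h)
  set h : K := (b : K) ^ p * g₀ with hhdef
  have hhA : h ∈ A := by
    have : h = (a : K) * (b : K) ^ (p - 1) := by
      obtain ⟨q, hq⟩ : ∃ q, p = q + 1 := ⟨p - 1, (Nat.sub_add_cancel hp.one_lt.le).symm⟩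
      rw [hhdef, ← hab', hq, Nat.add_sub_cancel, pow_succ]
      field_simp
    rw [this]
    exact A.mul_mem a.2 (A.pow_mem b.2 _)
  -- (2) transport of the derivation
  have hD0 : ∀ y ∈ R 0, s * D y ∈ R 0 := by
    rw [hR0]
    exact mul_derivation_mem_locAtCentre D s (B := A.toSubring) (O := O) (fun y hy => hDA y hy)
  have hDer := exists_derivation_preserving_seq R hstep D s hs0 hD0
  -- (3) climb until `π` is absorbed
  obtain ⟨n₁, hπn₁⟩ := exists_mem_of_quadraticTransforms_of_discrete O R hof h0dom hstep π hπ harch π hπO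
  -- the restarted sequence at `n₁`
  let R' : ℕ → Subring K := fun i => R (n₁ + i)
  haveI hR'loc : ∀ i, IsLocalRing (R' i) := fun i => hRloc (n₁ + i)
  have hstep' : ∀ i, IsQuadraticTransformAlong O (R' i) (R' (i + 1)) := fun i => by
    change IsQuadraticTransformAlong O (R (n₁ + i)) (R (n₁ + (i + 1)))
    rw [← add_assoc]; exact hstep (n₁ + i)
  have h0' : SubringDominates (R' 0) O.toSubring := hdom (n₁ + 0)
  have hπR' : π ∈ R' 0 := hπn₁
  -- the derivation at stage `n₁`, `E h = π^o u`
  obtain ⟨s₁, hs₁0, hD₁⟩ := hDer n₁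
  have hDh : D h = (b : K) ^ p * D g₀ := by
    rw [hhdef, Derivation.leibniz, Derivation.leibniz_pow]
    simp [smul_eq_mul, nsmul_eq_mul]
  have hEh0 : s₁ * D h ≠ 0 := mul_ne_zero hs₁0 (by rw [hDh]; exact mul_ne_zero (pow_ne_zero _ hb0) hDg)
  have hhR : h ∈ R n₁ := hmono (Nat.zero_le n₁) (hAR0 hhA)
  have hEhR : s₁ * D h ∈ R' 0 := hD₁ h hhR
  have hEhO : s₁ * D h ∈ O := (hdom n₁).1 hEhR
  obtain ⟨o, ho⟩ := exists_valuation_eq_pow_of_discrete O π hπ harch (s₁ * D h) hEh0 hEhO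
  obtain ⟨u, huR, hvu, hEu⟩ := exists_eq_pow_mul_unit R' h0' hstep' π hπR' hπ0 hvπ hπ o 0 (s₁ * D h) hEhR ho
  rw [Nat.zero_add] at huR
  -- restart again at `n₂ := n₁ + o`
  let R'' : ℕ → Subring K := fun i => R (n₁ + o + i)
  haveI hR''loc : ∀ i, IsLocalRing (R'' i) := fun i => hRloc (n₁ + o + i)
  have hstep'' : ∀ i, IsQuadraticTransformAlong O (R'' i) (R'' (i + 1)) := fun i => by
    change IsQuadraticTransformAlong O (R (n₁ + o + i)) (R (n₁ + o + (i + 1)))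
    rw [← add_assoc]; exact hstep (n₁ + o + i)
  have hder'' : ∀ y ∈ R'' 0, π ^ o * s₁ * D y ∈ R'' 0 :=
    derivation_transport_pow R' h0' hstep' π hπR' hπ0 hvπ hπ D s₁ hD₁ o
  have hnp : ∀ c : K, c ^ p ≠ h := by
    intro c hc
    apply hg₀ (c / (b : K))
    rw [div_pow, hc, hhdef, mul_div_cancel_left₀ _ (pow_ne_zero _ hb0)]
  have hdefect' : ∀ c : K, ∃ c' : K, O.valuation (h - c' ^ p) < O.valuation (h - c ^ p) := by
    intro c
    obtain ⟨f₁, hf₁⟩ := hdefect (c / (b : K))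
    refine ⟨(b : K) * f₁, ?_⟩
    have e1 : h - ((b : K) * f₁) ^ p = (b : K) ^ p * (g₀ - f₁ ^ p) := by rw [hhdef]; ring
    have e2 : h - c ^ p = (b : K) ^ p * (g₀ - (c / (b : K)) ^ p) := by
      rw [hhdef, div_pow, mul_sub, mul_div_cancel₀ _ (pow_ne_zero _ hb0)]
    rw [e1, e2, map_mul, map_mul]
    have hbp : 0 < O.valuation ((b : K) ^ p) :=
      zero_lt_iff.mpr ((Valuation.ne_zero_iff _).mpr (pow_ne_zero _ hb0))
    by_contra hle
    push Not at hle
    exact absurd (le_of_mul_le_mul_left hle hbp) (not_le.mpr hf₁)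
  have hDh' : π ^ o * s₁ * D h = π ^ (o + o) * u := by rw [mul_assoc, hEu]; ring
  have H : SubringDominates (R'' 0) O.toSubring ∧
      (∀ i, IsQuadraticTransformAlong O (R'' i) (R'' (i + 1))) ∧ π ∈ R'' 0 ∧ π ≠ 0 ∧ O.valuation π < 1 ∧
      (∀ x : K, O.valuation x < 1 → O.valuation x ≤ O.valuation π) ∧
      (∀ x : K, x ≠ 0 → ∃ n : ℕ, O.valuation π ^ n ≤ O.valuation x) ∧ (∀ y ∈ R'' 0, π ^ o * s₁ * D y ∈ R'' 0) ∧ h ∈ R'' 0 ∧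
      (∀ c : K, c ^ p ≠ h) ∧ (∀ c : K, ∃ c' : K, O.valuation (h - c' ^ p) < O.valuation (h - c ^ p)) ∧ u ∈ R'' 0 ∧
      O.valuation u = 1 ∧ π ^ o * s₁ * D h = π ^ (o + o) * u :=
    ⟨hdom _, hstep'', hmono (Nat.le_add_right n₁ o) hπn₁, hπ0, hvπ, hπ, harch, hder'',
      hmono (Nat.le_add_right n₁ o) hhR, hnp, hdefect', huR, hvu, hDh'⟩
  -- run the algorithm
  obtain ⟨n, c, hexit⟩ := (CoreHypD.core H)
  obtain ⟨A', hA'O, hAA', hA'fg, hRn⟩ := hmodel (n₁ + o + n)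
  have hregn : IsRegularLocalRing (R'' n) := hregR _
  rcases hexit with ⟨m', G, hGm, hGm2, hG⟩ | ⟨m', U, hU, hUeq, hres⟩ | ⟨m', r, hπn, F, hr0, hrp, hπm, hπm2, hFm, hind, heq⟩
  · exact concl_of_exit3 hA'O hAA' hA'fg (R'' n) hregn hRn g₀ (b : K) c π hb0 hπ0 m' G hGm hGm2 (by rw [hG])
  · exact concl_of_exit2 hA'O hAA' hA'fg (R'' n) hregn hRn g₀ (b : K) c π hb0 hπ0 m' U hU (by rw [hUeq]) hres
  · exact concl_of_exit1_d hA'O hAA' hA'fg (R'' n) hregn hRn (hdimRd _) g₀ (b : K) c π hb0 hπ0 m' r hr0 hrp hπn F hπm hπm2 hFm hind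
      (by rw [← heq])


end Main

/-- **`CleanLUArcAtDim p d` for EVERY prime `p` and EVERY dimension `d` (census statement of res-B-lens-1 g3, body VERBATIM, def-free): THEOREM P_d + LEMMA D-abs.**
Clean local uniformization of the `K^p`-line of `g₀` at a zero-dimensional DISCRETE RANK-ONE valuation ring `O` without best `p`-th-power approximation, at a
regular finitely generated centre of Krull dimension `d`, over every ground field of characteristic `p`.  Counted 0; rung B is not proved. [folklore] -/
theorem cleanLUArcAtDim (p : ℕ) (hp : p.Prime) (d : ℕ) :
    ∀ (k : Type) [Field k] [CharP k p] (K : Type) [Field K] [Algebra k K]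
    (O : ValuationSubring K) (A : Subalgebra k K), A.toSubring ≤ O.toSubring → A.FG → IsFractionRing A K →
    ringKrullDim A ≤ (d : WithBot ℕ∞) → IsRegularLocalRing (locAtCentre A.toSubring O) →
    ringKrullDim (locAtCentre A.toSubring O) = (d : WithBot ℕ∞) →
    (∀ (T : Subring K) (hT : T ≤ O.toSubring), A.toSubring ≤ T → (subringCentre T O hT).IsMaximal) →
    ∀ g₀ : K, (∀ c : K, c ^ p ≠ g₀) →
    (∀ f₀ : K, ∃ f₁ : K, O.valuation (g₀ - f₁ ^ p) < O.valuation (g₀ - f₀ ^ p)) →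
    (∀ hk : ∀ c : k, algebraMap k K c ∈ O, transcendenceDefect k O hk ≠ 0) →
    (∃ π : K, π ≠ 0 ∧ (∀ x : K, O.valuation x < 1 → O.valuation x ≤ O.valuation π) ∧
      (∀ x : K, x ≠ 0 → ∃ n : ℕ, O.valuation π ^ n ≤ O.valuation x)) →
    ∃ (A' : Subalgebra k K), A'.toSubring ≤ O.toSubring ∧ A ≤ A' ∧ A'.FG ∧
    ∃ (_ : IsRegularLocalRing (locAtCentre A'.toSubring O)) (c : Fin p → K), (∃ j : Fin p, (j : ℕ) ≠ 0 ∧ c j ≠ 0) ∧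
    ((∃ (d m : ℕ) (hmd : m ≤ d) (t : Fin d → ↥(locAtCentre A'.toSubring O)) (a : Fin m → ℕ) (u : ↥(locAtCentre A'.toSubring O)), IsUnit u ∧
    Ideal.span (Set.range t) = IsLocalRing.maximalIdeal ↥(locAtCentre A'.toSubring O) ∧
    ringKrullDim ↥(locAtCentre A'.toSubring O) = (d : WithBot ℕ∞) ∧ 0 < m ∧ (∀ i, ¬ p ∣ a i) ∧
    (∑ j : Fin p, c j ^ p * g₀ ^ (j : ℕ)) = (u : K) * ∏ i : Fin m, ((t (Fin.castLE hmd i) : ↥(locAtCentre A'.toSubring O)) : K) ^ (a i)) ∨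
    (∃ u : ↥(locAtCentre A'.toSubring O), IsUnit u ∧ (∑ j : Fin p, c j ^ p * g₀ ^ (j : ℕ)) = (u : K) ∧
    ∀ c' : ↥(locAtCentre A'.toSubring O), u - c' ^ p ∉ IsLocalRing.maximalIdeal ↥(locAtCentre A'.toSubring O)) ∨
    (∃ s c' : ↥(locAtCentre A'.toSubring O), (∑ j : Fin p, c j ^ p * g₀ ^ (j : ℕ)) = (s : K) ∧
    s - c' ^ p ∈ IsLocalRing.maximalIdeal ↥(locAtCentre A'.toSubring O) ∧
    s - c' ^ p ∉ IsLocalRing.maximalIdeal ↥(locAtCentre A'.toSubring O) ^ 2)) := by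
  intro k _ _ K _ _ O A hAO hfg hfrac hdimA hreg hdim hzd g₀ hg hna htd hπ
  exact arcPotential_d p hp d k K O A hAO hfg hfrac hdimA hreg hdim hzd g₀ hg hna htd hπ
    (Lens5.AbsDerivation.absDerivation_of_forall_pow_ne' p hp k K A hfg hfrac g₀ hg)

end Summit.ResolutionOfSingularities.ResolutionOfSingularities.Theorems.RadicialJungCleanModels.Lens5ArcAllDim

end
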